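import Summits.KontsevichZagierPeriods.KontsevichZagierPeriods.Theses.HurwitzMicroSectors
import Summits.KontsevichZagierPeriods.KontsevichZagierPeriods.Theorems.HurwitzMicroSectorsNormalFormPrinciplePiBoxTransfer
import Summits.KontsevichZagierPeriods.KontsevichZagierPeriods.Theorems.HurwitzMicroSectorsNormalFormPrincipleVariants2304

/-! TTRL-lite variant V2307 of stmt-KontsevichZagierPeriods-3869

Variant V2307 = `stub_boxRigidity` (the leaf `BoxRigidity` of `NormalFormPrinciple`: two representations
on open unit boxes with integrands of KZ's rational shape `p/q` over `ℚ` and equal values are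
KZ-equivalent) with BOTH dimensions frozen, `fix m := 6; fix m' := 4`. Verdict of the attempt seat:
**open** — this file is the exact-strength certificate, not a proof of the variant. Writing
`BoxVanishing K` for "a box-rational representation of dimension `K` and value `0` is a relation", the
frozen pair `(6, 4)` is exactly `BoxVanishing 6` (instance `max 6 4 = 6` of the tree's
`boxRigidityPair_iff_boxVanishingDim`: compare with the zero representation one way, pad by unit intervals
and subtract on the common box the other way), hence the SAME statement as the already-certified siblings
V2304 (pair `(6,3)`) and V2313 (pair `(6,6)`) (`boxRigidityPair_congr_max`), and as the bounded two-sided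
leaf `BoxRigidity(m, m' ≤ 6)`. Why open: `BoxVanishing 6 ⊇ BoxVanishing 5 ∋` "for `a b : ℚ`,
`a + b·ζ(5) = 0 ⇒ [a + b/(1 − x₁⋯x₅)]_{(0,1)⁵}` is a relation" (today only via `ζ(5) ∉ ℚ`, open; by
soundness no chain of moves exists unless `ζ(5) ∈ ℚ`), `⊇ BoxVanishing 2 ∋` Catalan's dichotomy;
conversely `KontsevichZagierPeriods → V2307` (`stub_boxRigidity_var2307_of_statement`), so a refutation
of the variant would refute the Summit, and the tree has no additive invariant of `KZ.relations` finer
than `KZ.eval`. Source: M. Kontsevich, D. Zagier, *Periods* (2001), §1.2 Conjecture 1 and rules 1)–3).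
Pure proof file, no definitions. -/

-- `Summit.<Summit>.<Problem>` is the tree's mandated summit-side namespace (CONVENTIONS §2); for this
-- single-conjunct summit the two coincide, so the duplicate is deliberate.
set_option linter.dupNamespace false

noncomputable section

namespace Summit.KontsevichZagierPeriods.KontsevichZagierPeriods.Theorems

open MeasureTheory Set
open Literature.NumberTheory.Transcendental Literature.NumberTheory.Transcendental.KZ
open Summit.KontsevichZagierPeriods.KontsevichZagierPeriods.Theses.HurwitzMicroSectors
open Summit.KontsevichZagierPeriods.HurwitzMicroSectors.NormalFormPrinciple.PiBox

/-! ## The variant V2307 itself: exactly `BoxVanishing 6` -/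

/-- **V2307 ⟺ `BoxVanishing 6`**: the freeze `(m, m') = (6, 4)` of `stub_boxRigidity` is the statement
that a box-rational representation on the `6`-box of value `0` is a relation (instance `(K, m₀) = (6, 4)`
of `boxRigidityPair_iff_boxVanishingDim`, `max 6 4 = 6`). [cite: KontsevichZagier2001, §1.2 Conjecture 1] -/
theorem stub_boxRigidity_var2307_iff_boxVanishing_six :
    (∀ (N : IntegralRep 6) (N' : IntegralRep 4), N.domain = {x | ∀ i, x i ∈ Set.Ioo (0:ℝ) 1} → N.IsRational → N'.domain = {x | ∀ i, x i ∈ Set.Ioo (0:ℝ) 1} → N'.IsRational → N.value = N'.value → Equivalent N N') ↔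
    (∀ (M : IntegralRep 6), M.domain = {x | ∀ i, x i ∈ Set.Ioo (0:ℝ) 1} →
      M.IsRational → M.value = 0 → of M ∈ relations) :=
  boxRigidityPair_iff_boxVanishingDim 6 4

/-- **V2307 ⟺ the two-sided bounded leaf `BoxRigidity(m, m' ≤ 6)`** (the honest strength of the
variant: Conjecture 1 for all pairs of rational integrands on the open unit boxes of dimension at most
`6` — among these periods `π²`, `π⁴`, `π⁶`, `ζ(3)`, `ζ(5)`, `ζ(3)²`, Catalan's `G` and every multiple zeta
value of weight `≤ 6`; freezing `m' := 4` rather than `6` loses nothing, by padding).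
[cite: KontsevichZagier2001, §1.2 Conjecture 1] -/
theorem stub_boxRigidity_var2307_iff_le_six :
    (∀ (N : IntegralRep 6) (N' : IntegralRep 4), N.domain = {x | ∀ i, x i ∈ Set.Ioo (0:ℝ) 1} → N.IsRational → N'.domain = {x | ∀ i, x i ∈ Set.Ioo (0:ℝ) 1} → N'.IsRational → N.value = N'.value → Equivalent N N') ↔
    (∀ (m m' : ℕ) (N : IntegralRep m) (N' : IntegralRep m'), m ≤ 6 → m' ≤ 6 →
      N.domain = {x | ∀ i, x i ∈ Set.Ioo (0:ℝ) 1} → N.IsRational →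
      N'.domain = {x | ∀ i, x i ∈ Set.Ioo (0:ℝ) 1} → N'.IsRational →
      N.value = N'.value → Equivalent N N') :=
  boxRigidityPair_iff_boxRigidityLe 6 4

/-- **V2307 ⟺ the sibling V2304** (`fix_nat:m=6; fix_nat:m'=3`): both pairs have larger dimension `6`
(`boxRigidityPair_congr_max`). [cite: KontsevichZagier2001, §1.2 Conjecture 1] -/
theorem stub_boxRigidity_var2307_iff_var2304 :
    (∀ (N : IntegralRep 6) (N' : IntegralRep 4), N.domain = {x | ∀ i, x i ∈ Set.Ioo (0:ℝ) 1} → N.IsRational → N'.domain = {x | ∀ i, x i ∈ Set.Ioo (0:ℝ) 1} → N'.IsRational → N.value = N'.value → Equivalent N N') ↔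
    (∀ (N : IntegralRep 6) (N' : IntegralRep 3), N.domain = {x | ∀ i, x i ∈ Set.Ioo (0:ℝ) 1} →
      N.IsRational → N'.domain = {x | ∀ i, x i ∈ Set.Ioo (0:ℝ) 1} → N'.IsRational →
      N.value = N'.value → Equivalent N N') :=
  boxRigidityPair_congr_max (by norm_num)

/-- **V2307 ⟺ the diagonal sibling V2313** (`fix_nat:m=6; fix_nat:m'=6`, literally `BoxRigidity` at
dimension `6`): again `boxRigidityPair_congr_max`. [cite: KontsevichZagier2001, §1.2 Conjecture 1] -/
theorem stub_boxRigidity_var2307_iff_var2313 :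
    (∀ (N : IntegralRep 6) (N' : IntegralRep 4), N.domain = {x | ∀ i, x i ∈ Set.Ioo (0:ℝ) 1} → N.IsRational → N'.domain = {x | ∀ i, x i ∈ Set.Ioo (0:ℝ) 1} → N'.IsRational → N.value = N'.value → Equivalent N N') ↔
    (∀ (N : IntegralRep 6) (N' : IntegralRep 6), N.domain = {x | ∀ i, x i ∈ Set.Ioo (0:ℝ) 1} →
      N.IsRational → N'.domain = {x | ∀ i, x i ∈ Set.Ioo (0:ℝ) 1} → N'.IsRational →
      N.value = N'.value → Equivalent N N') :=
  boxRigidityPair_congr_max (by norm_num)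

/-- **V2307 is the same statement as the swapped pair `(4, 6)`** (`boxRigidityPair_congr_max`;
equivalently, symmetry of `Equivalent`). [cite: KontsevichZagier2001, §1.2 Conjecture 1] -/
theorem stub_boxRigidity_var2307_iff_swap :
    (∀ (N : IntegralRep 6) (N' : IntegralRep 4), N.domain = {x | ∀ i, x i ∈ Set.Ioo (0:ℝ) 1} → N.IsRational → N'.domain = {x | ∀ i, x i ∈ Set.Ioo (0:ℝ) 1} → N'.IsRational → N.value = N'.value → Equivalent N N') ↔
    (∀ (N : IntegralRep 4) (N' : IntegralRep 6), N.domain = {x | ∀ i, x i ∈ Set.Ioo (0:ℝ) 1} →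
      N.IsRational → N'.domain = {x | ∀ i, x i ∈ Set.Ioo (0:ℝ) 1} → N'.IsRational →
      N.value = N'.value → Equivalent N N') :=
  boxRigidityPair_congr_max (by norm_num)

/-! ## Consequences downward, and the variant from above -/

/-- **V2307 ⇒ `BoxVanishing` in every dimension `j ≤ 6`**: compare a vanishing box-rational
representation on `(0,1)ʲ` with the zero representation on the same box, via the bounded leaf
(`stub_boxRigidity_var2307_iff_le_six`); in particular the dimension-`5` statement containing the `ζ(5)`
dichotomy and the dimension-`2` one containing Catalan's. [cite: KontsevichZagier2001, §1.2 Conjecture 1] -/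
theorem boxVanishing_le_six_of_stub_boxRigidity_var2307
    (h : ∀ (N : IntegralRep 6) (N' : IntegralRep 4), N.domain = {x | ∀ i, x i ∈ Set.Ioo (0:ℝ) 1} → N.IsRational → N'.domain = {x | ∀ i, x i ∈ Set.Ioo (0:ℝ) 1} → N'.IsRational → N.value = N'.value → Equivalent N N')
    {j : ℕ} (hj : j ≤ 6) (N : IntegralRep j) (hNd : N.domain = {x | ∀ i, x i ∈ Set.Ioo (0:ℝ) 1})
    (hNr : N.IsRational) (hv : N.value = 0) : of N ∈ relations := by
  have hpair : ∀ (N : IntegralRep j) (N' : IntegralRep j), N.domain = {x | ∀ i, x i ∈ Set.Ioo (0:ℝ) 1} →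
      N.IsRational → N'.domain = {x | ∀ i, x i ∈ Set.Ioo (0:ℝ) 1} → N'.IsRational →
      N.value = N'.value → Equivalent N N' :=
    fun N N' => stub_boxRigidity_var2307_iff_le_six.1 h j j N N' hj hj
  have hvan := (boxRigidityPair_iff_boxVanishingDim j j).1 hpair
  rw [max_self] at hvan
  exact hvan N hNd hNr hv

/-- **`BoxVanishing 6` alone already proves V2307** (the honest residual of the variant, stated as the
missing lemma: whoever settles Conjecture 1 for vanishing box-rational periods of dimension `6` settles
V2307, and conversely). [cite: KontsevichZagier2001, §1.2 Conjecture 1] -/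
theorem stub_boxRigidity_var2307_of_boxVanishing_six
    (hvan : ∀ (M : IntegralRep 6), M.domain = {x | ∀ i, x i ∈ Set.Ioo (0:ℝ) 1} → M.IsRational →
      M.value = 0 → of M ∈ relations) :
    ∀ (N : IntegralRep 6) (N' : IntegralRep 4), N.domain = {x | ∀ i, x i ∈ Set.Ioo (0:ℝ) 1} → N.IsRational → N'.domain = {x | ∀ i, x i ∈ Set.Ioo (0:ℝ) 1} → N'.IsRational → N.value = N'.value → Equivalent N N' :=
  stub_boxRigidity_var2307_iff_boxVanishing_six.2 hvan

/-- **The parent leaf ⇒ V2307** (specialisation `m := 6`, `m' := 4`; the converse is not claimed —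
the parent is `BoxVanishing` in ALL dimensions). [cite: KontsevichZagier2001, §1.2 Conjecture 1] -/
theorem stub_boxRigidity_var2307_of_parent
    (h : ∀ (m m' : ℕ) (N : IntegralRep m) (N' : IntegralRep m'), N.domain = {x | ∀ i, x i ∈ Set.Ioo (0:ℝ) 1} → N.IsRational → N'.domain = {x | ∀ i, x i ∈ Set.Ioo (0:ℝ) 1} → N'.IsRational → N.value = N'.value → Equivalent N N') :
    ∀ (N : IntegralRep 6) (N' : IntegralRep 4), N.domain = {x | ∀ i, x i ∈ Set.Ioo (0:ℝ) 1} → N.IsRational → N'.domain = {x | ∀ i, x i ∈ Set.Ioo (0:ℝ) 1} → N'.IsRational → N.value = N'.value → Equivalent N N' :=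
  h 6 4

/-- **`KontsevichZagierPeriods ⇒ V2307`**: the variant is a special case of Conjecture 1 for the
tree's calculus (`leaves_of_statement`) — so a refutation of the variant would refute the Summit.
[cite: KontsevichZagier2001, §1.2 Conjecture 1] -/
theorem stub_boxRigidity_var2307_of_statement (h : _root_.KontsevichZagierPeriods) :
    ∀ (N : IntegralRep 6) (N' : IntegralRep 4), N.domain = {x | ∀ i, x i ∈ Set.Ioo (0:ℝ) 1} → N.IsRational → N'.domain = {x | ∀ i, x i ∈ Set.Ioo (0:ℝ) 1} → N'.IsRational → N.value = N'.value → Equivalent N N' :=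
  (leaves_of_statement h).1 6 4

end Summit.KontsevichZagierPeriods.KontsevichZagierPeriods.Theorems

end
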